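import Summits.HubbardSuperconductivity.HubbardSuperconductivity.Theorems.WidthHaldaneTubePlaneWaves
import Summits.HubbardSuperconductivity.HubbardSuperconductivity.Theorems.WidthHaldaneKineticFloor

/-!
# The hopping split of the Hubbard tube: longitudinal kinetic form + transverse hopping + interaction

Support file for the tube cruxes stated over `WidthHaldaneDefs` (routes `WidthHaldane`,
`SeamInduction`; items stmt-HubbardSuperconductivity-16311/16312/18509/18510), all PROVED, no
definitions, no named facts. Input for the KINETIC FLOOR hypothesis of the Landau-form lines of crux
stmt-16312 (idea card `landau-window-yrast`; registered sub-goal `stiffnessOfLandauCriterion`,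
`WidthHaldaneTubeLandauCriterion` / `WidthHaldaneTubeLandauLocalisation`), whose window states must be
shown to keep their longitudinal kinetic energy. On the labelled carrier `e : Λ ≃ ℤ/L × ℤ/M` the bond
graph `tubeGraph e` is the edge-disjoint union of the LONGITUDINAL graph `G_∥ = fromRel (y = x + e₁)`
and the TRANSVERSE graph `G_⊥ = fromRel (y = x + e₂)` (`L` rings of length `M`), both written out:

* `tubeGraph_adj_iff_long_or_trans`, `longGraph_adj_iff`, `transGraph_adj_iff`, `not_long_and_trans`,
  `ite_tubeGraph_adj_eq_add`, `ite_longGraph_adj_eq`, `sum_transGraph_adj` — the bond bookkeeping;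
* `tubeH0_eq_zero_add_smul` — `H₀(U) = H₀(0) + U Σ_x n_{x↑}n_{x↓}`;
* **`re_expect_tubeH0_eq_neg_longKinetic_add`** — THE HOPPING SPLIT (`L ≥ 3`, `M ≥ 2`):
  `Re⟨ψ, H₀(U)ψ⟩ = -K(ψ) + Re⟨ψ, T_⊥ ψ⟩ + U·Re⟨ψ, Σ n↑n↓ ψ⟩` with the longitudinal kinetic form
  `K(ψ) = Σ_{a,b,σ} Re⟨ψ,(c†_{(a,b)σ}c_{(a-1,b)σ} + h.c.)ψ⟩` of `WidthHaldaneKineticFloor` /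
  `WidthHaldaneTubeLandauForm` and `T_⊥ = hamiltonian G_⊥ 1 0`;
* `planeWave_orthonormal`, `planeWave_complete`, **`transAdj_mulVec_planeWave`** — the normalised
  plane waves `χ_k/√(LM)` (`tubeChar`) form a complete orthonormal eigenbasis of the transverse
  adjacency: `A_⊥ χ_k = -2cos(2πk₂/M) χ_k` (`M ≥ 3`), ready for the bathtub bound of
  `Literature/FreeFermionGraphSectorFloor` (used in `WidthHaldaneTubeKineticWindow`).

References: D. J. Scalapino, S. R. White, S. C. Zhang, PRB 47 (1993) 7995, §II (`D_s/π ≤ ⟨-k_x⟩`);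
E. H. Lieb, M. Loss, *Analysis* (2001) Thm 1.14 (bathtub); idea card `landau-window-yrast` (crux 16312).
-/

noncomputable section

namespace Summit.HubbardSuperconductivity.HubbardSuperconductivity.Theorems.WidthHaldane

set_option linter.dupNamespace false -- summit = problem name (single-conjunct summit), D-0017

open scoped BigOperators Classical Matrix ComplexConjugate
open Matrix Literature.MathematicalPhysics.QuantumLattice
open Summit.HubbardSuperconductivity.HubbardSuperconductivity.Theorems.DeformationLadder
  (expect_hamiltonian_eq)

section Graphs

variable (L M : ℕ) [NeZero L] [NeZero M] (Λ : Type) [LinearOrder Λ] [Fintype Λ]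
  (e : Λ ≃ ZMod L × ZMod M)

omit [NeZero L] [NeZero M] [Fintype Λ] in
/-- **The tube graph is the union of its longitudinal and transverse bond graphs**:
`x ∼ y` in `ℤ/L × ℤ/M` iff `x ∼ y` longitudinally (`y = x ± e₁`) or transversally (`y = x ± e₂`).
[folklore] -/
theorem tubeGraph_adj_iff_long_or_trans (x y : Λ) :
    (tubeGraph e).Adj x y ↔
      (SimpleGraph.fromRel fun x y : Λ => y = e.symm ((e x).1 + 1, (e x).2)).Adj x y ∨
        (SimpleGraph.fromRel fun x y : Λ => y = e.symm ((e x).1, (e x).2 + 1)).Adj x y := by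
  simp only [SimpleGraph.fromRel_adj]
  tauto

omit [NeZero L] [NeZero M] [LinearOrder Λ] [Fintype Λ] in
/-- Longitudinal adjacency in coordinates (`L ≥ 2`): `x = y + e₁` or `y = x + e₁`. [folklore] -/
theorem longGraph_adj_iff (hL : 2 ≤ L) (x y : Λ) :
    (SimpleGraph.fromRel fun x y : Λ => y = e.symm ((e x).1 + 1, (e x).2)).Adj x y ↔
      ((e x).1 = (e y).1 + 1 ∧ (e x).2 = (e y).2) ∨ ((e y).1 = (e x).1 + 1 ∧ (e x).2 = (e y).2) := by
  haveI : Fact (1 < L) := ⟨by omega⟩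
  rw [SimpleGraph.fromRel_adj, ← longitudinal_iff_right L M Λ e x y]
  have hl : x = e.symm ((e y).1 + 1, (e y).2) ↔ ((e x).1 = (e y).1 + 1 ∧ (e x).2 = (e y).2) := by
    rw [← longitudinal_iff_right L M Λ e y x]
    exact ⟨fun h => ⟨h.1, h.2.symm⟩, fun h => ⟨h.1, h.2.symm⟩⟩
  rw [hl]
  constructor
  · rintro ⟨-, h | h⟩
    · exact Or.inr h
    · exact Or.inl h
  · intro h
    refine ⟨fun hxy => ?_, h.symm⟩
    subst hxy
    rcases h with h | h
    · exact one_ne_zero (by linear_combination -h.1 : (1 : ZMod L) = 0)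
    · exact one_ne_zero (by linear_combination -h.1 : (1 : ZMod L) = 0)

omit [NeZero L] [NeZero M] [LinearOrder Λ] [Fintype Λ] in
/-- Transverse adjacency in coordinates (`M ≥ 2`): `x = y + e₂` or `y = x + e₂`. [folklore] -/
theorem transGraph_adj_iff (hM : 2 ≤ M) (x y : Λ) :
    (SimpleGraph.fromRel fun x y : Λ => y = e.symm ((e x).1, (e x).2 + 1)).Adj x y ↔
      ((e x).2 = (e y).2 + 1 ∧ (e x).1 = (e y).1) ∨ ((e y).2 = (e x).2 + 1 ∧ (e x).1 = (e y).1) := by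
  haveI : Fact (1 < M) := ⟨by omega⟩
  have k : ∀ u v : Λ, v = e.symm ((e u).1, (e u).2 + 1) ↔ ((e v).2 = (e u).2 + 1 ∧ (e u).1 = (e v).1) := by
    intro u v
    rw [Equiv.eq_symm_apply, Prod.ext_iff]
    exact ⟨fun h => ⟨h.2, h.1.symm⟩, fun h => ⟨h.2.symm, h.1⟩⟩
  rw [SimpleGraph.fromRel_adj, k, k]
  constructor
  · rintro ⟨-, h | h⟩
    · exact Or.inr h
    · exact Or.inl ⟨h.1, h.2.symm⟩
  · intro h
    refine ⟨fun hxy => ?_, ?_⟩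
    · subst hxy
      rcases h with h | h
      · exact one_ne_zero (by linear_combination -h.1 : (1 : ZMod M) = 0)
      · exact one_ne_zero (by linear_combination -h.1 : (1 : ZMod M) = 0)
    · rcases h with h | h
      · exact Or.inr ⟨h.1, h.2.symm⟩
      · exact Or.inl h

omit [NeZero L] [NeZero M] [LinearOrder Λ] [Fintype Λ] in
/-- A bond is not both longitudinal and transverse (`M ≥ 2`). [folklore] -/
theorem not_long_and_trans (hL : 2 ≤ L) (hM : 2 ≤ M) (x y : Λ)
    (hl : (SimpleGraph.fromRel fun x y : Λ => y = e.symm ((e x).1 + 1, (e x).2)).Adj x y)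
    (ht : (SimpleGraph.fromRel fun x y : Λ => y = e.symm ((e x).1, (e x).2 + 1)).Adj x y) : False := by
  haveI : Fact (1 < M) := ⟨by omega⟩
  rw [longGraph_adj_iff L M Λ e hL] at hl
  rw [transGraph_adj_iff L M Λ e hM] at ht
  have h2 : (e x).2 = (e y).2 := by
    rcases hl with h | h
    · exact h.2
    · exact h.2
  rcases ht with h | h
  · exact one_ne_zero (by linear_combination h2 - h.1 : (1 : ZMod M) = 0)
  · exact one_ne_zero (by linear_combination -h2 - h.1 : (1 : ZMod M) = 0)

omit [NeZero L] [NeZero M] [Fintype Λ] in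
/-- **The hopping indicator splits**: `[x ∼ y] f = [x ∼_long y] f + [x ∼_trans y] f` (`L, M ≥ 2`).
[folklore] -/
theorem ite_tubeGraph_adj_eq_add (hL : 2 ≤ L) (hM : 2 ≤ M) {β : Type*} [AddCommMonoid β] (x y : Λ) (f : β) :
    (if (tubeGraph e).Adj x y then f else 0) =
      (if (SimpleGraph.fromRel fun x y : Λ => y = e.symm ((e x).1 + 1, (e x).2)).Adj x y then f else 0) +
        (if (SimpleGraph.fromRel fun x y : Λ => y = e.symm ((e x).1, (e x).2 + 1)).Adj x y then f else 0) := by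
  rw [if_congr (tubeGraph_adj_iff_long_or_trans L M Λ e x y) rfl rfl]
  by_cases hl : (SimpleGraph.fromRel fun x y : Λ => y = e.symm ((e x).1 + 1, (e x).2)).Adj x y
  · have ht : ¬ (SimpleGraph.fromRel fun x y : Λ => y = e.symm ((e x).1, (e x).2 + 1)).Adj x y :=
      fun ht => not_long_and_trans L M Λ e hL hM x y hl ht
    rw [if_pos (Or.inl hl), if_pos hl, if_neg ht, add_zero]
  · by_cases ht : (SimpleGraph.fromRel fun x y : Λ => y = e.symm ((e x).1, (e x).2 + 1)).Adj x y
    · rw [if_pos (Or.inr ht), if_neg hl, if_pos ht, zero_add]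
    · rw [if_neg (fun h => h.elim hl ht), if_neg hl, if_neg ht, add_zero]

omit [NeZero L] [NeZero M] [Fintype Λ] in
/-- **The longitudinal indicator as the sum of its two orientations** (`L ≥ 3`):
`[x ∼_long y] = [x = y + e₁] + [y = x + e₁]`. [folklore] -/
theorem ite_longGraph_adj_eq (hL : 3 ≤ L) (x y : Λ) (r : ℝ) :
    (if (SimpleGraph.fromRel fun x y : Λ => y = e.symm ((e x).1 + 1, (e x).2)).Adj x y then r else 0) =
      ((if (e x).1 = (e y).1 + 1 ∧ (e x).2 = (e y).2 then 1 else 0) +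
        (if (e y).1 = (e x).1 + 1 ∧ (e x).2 = (e y).2 then 1 else 0)) * r := by
  rw [if_congr (longGraph_adj_iff L M Λ e (by omega) x y) rfl rfl]
  by_cases h1 : (e x).1 = (e y).1 + 1 ∧ (e x).2 = (e y).2
  · have h2 : ¬ ((e y).1 = (e x).1 + 1 ∧ (e x).2 = (e y).2) := fun h2 => not_both_steps L hL h1.1 h2.1
    rw [if_pos (Or.inl h1), if_pos h1, if_neg h2]
    ring
  · by_cases h2 : (e y).1 = (e x).1 + 1 ∧ (e x).2 = (e y).2
    · rw [if_pos (Or.inr h2), if_neg h1, if_pos h2]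
      ring
    · rw [if_neg (fun h => h.elim h1 h2), if_neg h1, if_neg h2]
      ring

omit [NeZero L] [NeZero M] in
/-- **The transverse neighbour sum** (`M ≥ 3`): `Σ_y [x ∼_trans y] f(y) = f(x + e₂) + f(x - e₂)`.
[folklore] -/
theorem sum_transGraph_adj (hM : 3 ≤ M) {β : Type*} [AddCommMonoid β] (f : Λ → β) (x : Λ) :
    ∑ y : Λ, (if (SimpleGraph.fromRel fun x y : Λ => y = e.symm ((e x).1, (e x).2 + 1)).Adj x y then f y else 0) =
      f (e.symm ((e x).1, (e x).2 + 1)) + f (e.symm ((e x).1, (e x).2 - 1)) := by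
  haveI : Fact (1 < M) := ⟨by omega⟩
  have hup : ∀ y : Λ, ((e y).2 = (e x).2 + 1 ∧ (e x).1 = (e y).1) ↔ y = e.symm ((e x).1, (e x).2 + 1) := by
    intro y
    rw [Equiv.eq_symm_apply, Prod.ext_iff]
    exact ⟨fun h => ⟨h.2.symm, h.1⟩, fun h => ⟨h.2, h.1.symm⟩⟩
  have hdn : ∀ y : Λ, ((e x).2 = (e y).2 + 1 ∧ (e x).1 = (e y).1) ↔ y = e.symm ((e x).1, (e x).2 - 1) := by
    intro y
    rw [Equiv.eq_symm_apply, Prod.ext_iff]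
    constructor
    · rintro ⟨h1, h2⟩
      exact ⟨h2.symm, by rw [h1]; ring⟩
    · rintro ⟨h1, h2⟩
      exact ⟨by rw [h2]; ring, h1.symm⟩
  have hsplit : ∀ y : Λ, (if (SimpleGraph.fromRel fun x y : Λ => y = e.symm ((e x).1, (e x).2 + 1)).Adj x y
      then f y else 0) =
      (if y = e.symm ((e x).1, (e x).2 + 1) then f y else 0) + (if y = e.symm ((e x).1, (e x).2 - 1) then f y else 0) := by
    intro y
    rw [if_congr ((transGraph_adj_iff L M Λ e (by omega) x y).trans (or_congr (hdn y) (hup y))) rfl rfl]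
    by_cases h1 : y = e.symm ((e x).1, (e x).2 + 1)
    · have h2 : ¬ y = e.symm ((e x).1, (e x).2 - 1) := by
        intro h2
        have h := congrArg (fun z => (e z).2) (h1.symm.trans h2)
        simp only [Equiv.apply_symm_apply] at h
        exact two_ne_zero_zmod M hM (by linear_combination h)
      rw [if_pos (Or.inr h1), if_pos h1, if_neg h2, add_zero]
    · by_cases h2 : y = e.symm ((e x).1, (e x).2 - 1)
      · rw [if_pos (Or.inl h2), if_neg h1, if_pos h2, zero_add]
      · rw [if_neg (fun h => h.elim h2 h1), if_neg h1, if_neg h2, add_zero]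
  simp_rw [hsplit]
  rw [Finset.sum_add_distrib, Finset.sum_ite_eq' Finset.univ, Finset.sum_ite_eq' Finset.univ,
    if_pos (Finset.mem_univ _), if_pos (Finset.mem_univ _)]

end Graphs

section Split

variable (L M : ℕ) [NeZero L] [NeZero M] (Λ : Type) [LinearOrder Λ] [Fintype Λ]
  (e : Λ ≃ ZMod L × ZMod M)

omit [NeZero L] [NeZero M] in
/-- The interaction enters `tubeH0` linearly: `H₀(U) = H₀(0) + U Σ_x n_{x↑}n_{x↓}`. [folklore] -/
theorem tubeH0_eq_zero_add_smul (U : ℝ) :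
    tubeH0 L M Λ e U = tubeH0 L M Λ e 0 + (U : ℂ) • ∑ x : Λ, numberOp x 0 * numberOp x 1 := by
  rw [tubeH0_eq, tubeH0_eq, hamiltonian, hamiltonian, Complex.ofReal_zero, zero_smul, add_zero]

/-- **THE HOPPING SPLIT OF THE TUBE, in expectation** (`L ≥ 3`, `M ≥ 2`): for every vector `ψ`,
`Re⟨ψ, H₀(U)ψ⟩ = -K(ψ) + Re⟨ψ, T_⊥ ψ⟩ + U·Re⟨ψ, Σ_x n_{x↑}n_{x↓} ψ⟩`, where
`K(ψ) = Σ_{a,b,σ} Re⟨ψ,(c†_{(a,b)σ}c_{(a-1,b)σ} + h.c.)ψ⟩` is the longitudinal kinetic form (column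
coordinates of `WidthHaldaneKineticFloor` / `WidthHaldaneTubeLandauForm`) and
`T_⊥ = hamiltonian G_⊥ 1 0` is the free hopping Hamiltonian of the TRANSVERSE bond graph
`G_⊥ = fromRel (y = x + e₂)` (a disjoint union of `L` rings of length `M`). [folklore] -/
theorem re_expect_tubeH0_eq_neg_longKinetic_add (hL : 3 ≤ L) (hM : 2 ≤ M) (U : ℝ) (ψ : Fock (Orb Λ)) :
    (expect (tubeH0 L M Λ e U) ψ).re =
      -(∑ a : ZMod L, ∑ b : ZMod M, ∑ σ : Fin 2,
          (expect (creation (orb (e.symm (a, b)) σ) * annihilation (orb (e.symm (a - 1, b)) σ) +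
            creation (orb (e.symm (a - 1, b)) σ) * annihilation (orb (e.symm (a, b)) σ)) ψ).re) +
        (expect (hamiltonian (SimpleGraph.fromRel fun x y : Λ => y = e.symm ((e x).1, (e x).2 + 1)) 1 0) ψ).re +
        U * (expect (∑ x : Λ, numberOp x 0 * numberOp x 1) ψ).re := by
  rw [tubeH0_eq, expect_hamiltonian_eq, expect_hamiltonian_eq]
  simp only [Complex.ofReal_one, Complex.ofReal_zero, zero_mul, add_zero, neg_one_mul,
    Complex.add_re, Complex.neg_re, Complex.re_ofReal_mul]
  -- the hopping sum splits; its longitudinal part is `K`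
  have h : (∑ x : Λ, ∑ y : Λ, ∑ σ : Fin 2,
      (if (tubeGraph e).Adj x y then expect (creation (orb x σ) * annihilation (orb y σ)) ψ else 0)).re =
      (∑ a : ZMod L, ∑ b : ZMod M, ∑ σ : Fin 2,
          (expect (creation (orb (e.symm (a, b)) σ) * annihilation (orb (e.symm (a - 1, b)) σ) +
            creation (orb (e.symm (a - 1, b)) σ) * annihilation (orb (e.symm (a, b)) σ)) ψ).re) +
        (∑ x : Λ, ∑ y : Λ, ∑ σ : Fin 2,
          (if (SimpleGraph.fromRel fun x y : Λ => y = e.symm ((e x).1, (e x).2 + 1)).Adj x y then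
            expect (creation (orb x σ) * annihilation (orb y σ)) ψ else 0)).re := by
    simp only [expect_add, Complex.add_re]
    rw [← sum_longitudinal_eq L M Λ e (fun x y σ => (expect (creation (orb x σ) * annihilation (orb y σ)) ψ).re)]
    simp only [Complex.re_sum, ← Finset.sum_add_distrib]
    refine Finset.sum_congr rfl fun x _ => Finset.sum_congr rfl fun y _ => Finset.sum_congr rfl fun σ _ => ?_
    rw [apply_ite Complex.re, apply_ite Complex.re, Complex.zero_re,
      ite_tubeGraph_adj_eq_add L M Λ e (by omega) hM, ite_longGraph_adj_eq L M Λ e hL]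
  rw [h]
  ring

end Split

section TransverseModes

variable (L M : ℕ) [NeZero L] [NeZero M] (Λ : Type) [LinearOrder Λ] [Fintype Λ]
  (e : Λ ≃ ZMod L × ZMod M)

omit [LinearOrder Λ] in
/-- **Orthonormality of the normalised plane waves as site functions**:
`⟨χ_k/√(LM), χ_l/√(LM)⟩ = [k = l]`. [folklore] -/
theorem planeWave_orthonormal (k l : ZMod L × ZMod M) :
    star (fun x : Λ => (((Real.sqrt ((L : ℝ) * M))⁻¹ : ℝ) : ℂ) * tubeChar L M k (e x)) ⬝ᵥ
        (fun x : Λ => (((Real.sqrt ((L : ℝ) * M))⁻¹ : ℝ) : ℂ) * tubeChar L M l (e x)) =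
      if k = l then 1 else 0 := by
  simp only [dotProduct, Pi.star_apply, star_mul', Complex.star_def, Complex.conj_ofReal]
  have h : ∀ x : Λ, (((Real.sqrt ((L : ℝ) * M))⁻¹ : ℝ) : ℂ) * conj (tubeChar L M k (e x)) *
      ((((Real.sqrt ((L : ℝ) * M))⁻¹ : ℝ) : ℂ) * tubeChar L M l (e x)) =
      (((Real.sqrt ((L : ℝ) * M))⁻¹ : ℝ) : ℂ) * (((Real.sqrt ((L : ℝ) * M))⁻¹ : ℝ) : ℂ) *
        (conj (tubeChar L M k (e x)) * tubeChar L M l (e x)) := fun x => by ring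
  simp_rw [h]
  rw [← Finset.mul_sum, show (∑ x : Λ, conj (tubeChar L M k (e x)) * tubeChar L M l (e x)) =
      ∑ p : ZMod L × ZMod M, conj (tubeChar L M k p) * tubeChar L M l p from
    e.sum_comp (fun p => conj (tubeChar L M k p) * tubeChar L M l p), sum_conj_tubeChar_mul_tubeChar]
  split_ifs
  · exact_mod_cast sqrt_inv_mul_self_mul (L := L) (M := M)
  · rw [mul_zero]

omit [Fintype Λ] in
/-- **Completeness of the normalised plane waves as site functions**:
`Σ_k χ_k(x) conj χ_k(y) / (LM) = [x = y]`. [folklore] -/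
theorem planeWave_complete (x y : Λ) :
    ∑ k : ZMod L × ZMod M, (((Real.sqrt ((L : ℝ) * M))⁻¹ : ℝ) : ℂ) * tubeChar L M k (e x) *
        star ((((Real.sqrt ((L : ℝ) * M))⁻¹ : ℝ) : ℂ) * tubeChar L M k (e y)) =
      if x = y then 1 else 0 := by
  simp only [star_mul', Complex.star_def, Complex.conj_ofReal]
  have h : ∀ k : ZMod L × ZMod M, (((Real.sqrt ((L : ℝ) * M))⁻¹ : ℝ) : ℂ) * tubeChar L M k (e x) *
      ((((Real.sqrt ((L : ℝ) * M))⁻¹ : ℝ) : ℂ) * conj (tubeChar L M k (e y))) =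
      (((Real.sqrt ((L : ℝ) * M))⁻¹ : ℝ) : ℂ) * (((Real.sqrt ((L : ℝ) * M))⁻¹ : ℝ) : ℂ) *
        (conj (tubeChar L M (e y) k) * tubeChar L M (e x) k) := fun k => by
    rw [tubeChar_comm k (e x), tubeChar_comm k (e y)]; ring
  simp_rw [h, conj_tubeChar_mul_tubeChar]
  rw [← Finset.mul_sum, sum_tubeChar]
  by_cases hxy : x = y
  · subst hxy
    rw [if_pos (sub_self _), if_pos rfl]
    exact_mod_cast sqrt_inv_mul_self_mul (L := L) (M := M)
  · rw [if_neg (fun h' => hxy (e.injective (sub_eq_zero.mp h'))), if_neg hxy, mul_zero]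

/-- **Plane waves diagonalise the transverse hopping** (`M ≥ 3`): for the adjacency matrix `A_⊥`
(`-1` on transverse bonds) of `G_⊥ = fromRel (y = x + e₂)`, `A_⊥ χ_k = -2cos(2πk₂/M) χ_k`. [folklore] -/
theorem transAdj_mulVec_planeWave (hM : 3 ≤ M) (k : ZMod L × ZMod M) :
    (Matrix.of fun x y : Λ => if (SimpleGraph.fromRel fun x y : Λ => y = e.symm ((e x).1, (e x).2 + 1)).Adj x y then (-1 : ℂ) else 0) *ᵥ
        (fun x : Λ => (((Real.sqrt ((L : ℝ) * M))⁻¹ : ℝ) : ℂ) * tubeChar L M k (e x)) =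
      (((-2 * Real.cos (2 * Real.pi * (k.2.val : ℝ) / M) : ℝ) : ℂ)) •
        (fun x : Λ => (((Real.sqrt ((L : ℝ) * M))⁻¹ : ℝ) : ℂ) * tubeChar L M k (e x)) := by
  set c : ℂ := (((Real.sqrt ((L : ℝ) * M))⁻¹ : ℝ) : ℂ) with hc
  funext x
  rw [Matrix.mulVec, dotProduct, Pi.smul_apply, smul_eq_mul]
  simp only [Matrix.of_apply, ite_mul, neg_one_mul, zero_mul]
  rw [show (∑ y : Λ, if (SimpleGraph.fromRel fun x y : Λ => y = e.symm ((e x).1, (e x).2 + 1)).Adj x y then -(c * tubeChar L M k (e y)) else 0) =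
      -∑ y : Λ, (if (SimpleGraph.fromRel fun x y : Λ => y = e.symm ((e x).1, (e x).2 + 1)).Adj x y then c * tubeChar L M k (e y) else 0) by
    rw [← Finset.sum_neg_distrib]
    refine Finset.sum_congr rfl fun y _ => ?_
    split_ifs <;> simp]
  rw [sum_transGraph_adj L M Λ e hM]
  simp only [Equiv.apply_symm_apply]
  have hup : ((e x).1, (e x).2 + 1) = e x + (0, 1) := by ext <;> simp
  have hdn : ((e x).1, (e x).2 - 1) = e x - (0, 1) := by ext <;> simp
  have e2 : tubeChar L M k (0, 1) = ZMod.stdAddChar k.2 := by simp [tubeChar]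
  have e2' : tubeChar L M k (-(0, 1)) = ZMod.stdAddChar (-k.2) := by
    rw [tubeChar_neg_right, e2, AddChar.map_neg_eq_conj]
  rw [hup, hdn, sub_eq_add_neg, tubeChar_add_right, tubeChar_add_right, e2, e2']
  have h2 := stdAddChar_add_stdAddChar_neg k.2
  push_cast at h2 ⊢
  linear_combination -(c * tubeChar L M k (e x)) * h2

end TransverseModes

end Summit.HubbardSuperconductivity.HubbardSuperconductivity.Theorems.WidthHaldane

end
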